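import Literature.AlgebraicGeometry.Frobenioids.Thm42Sub
import HarnessLib

/-!
# [FrdI] Theorem 4.2 (i)(ii): sub-lemmas T42-L09 – L11 (functoriality of `Ψ^Prime`, Div-identity
# endomorphisms) — statements (S5 sub-DAG, part II)

Mochizuki, *The geometry of Frobenioids I: the general theory*, Kyushu J. Math. **62** (2008)
293–400, §4, Theorem 4.2, proof p. 80 l. 34 – p. 81 l. 31 [cite: MochizukiFrdI2008, Thm. 4.2 p.80].
STATEMENTS-ONLY companion of `Thm42Sub.lean` (same conventions; `T42.Setting`, nothing asserted): rows
`T42-L09` `PsiPrimeFunctorialFrobeniusType`, `T42-L10` `PsiPrimeFunctorialPreStep` (compatibility of the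
family `e = Ψ^Prime` of row L08 with `Prime(Φ_i(−))` along morphisms of Frobenius type / pre-steps, p. 80
l. 34 – p. 81 l. 4) and `T42-L11` `DivIdentityEndoCharacterisation` / `PreservesDivIdentity` (p. 81
ll. 5–31). All OPEN (holder abc-iut-L1-t14).
-/

namespace Literature.AlgebraicGeometry.Frobenioids

open CategoryTheory Opposite

namespace FrdI.T42

universe w v v' u u'

variable {D₁ : Type u} [Category.{v} D₁] {Φ₁ : D₁ᵒᵖ ⥤ CommMonCat.{w}} {C₁ : Type u'} [Category.{v'} C₁]
  {D₂ : Type u} [Category.{v} D₂] {Φ₂ : D₂ᵒᵖ ⥤ CommMonCat.{w}} {C₂ : Type u'} [Category.{v'} C₂]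

/-! ## T42-L09, L10 — functoriality of `Ψ^Prime` (p. 80 l. 34 – p. 81 l. 4) -/

/-- The compatibility square asserted by rows L09/L10 for a base-isomorphism `γ : A → A'` of `C₁`: primes
`𝔭 ⊆ Φ₁(A)`, `𝔭' ⊆ Φ₁(A')` corresponding under `Φ₁(Base γ)` are carried by the family `e` to primes
corresponding under `Φ₂(Base (Ψ γ))`. [cite: MochizukiFrdI2008, Thm. 4.2 (ii) p.80] -/
def PrimesCompatibleAlong (F₁ : C₁ ⥤ ElemFrobenioid Φ₁) (F₂ : C₂ ⥤ ElemFrobenioid Φ₂) (Ψ : C₁ ≌ C₂)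
    (e : ∀ A : C₁, Primes (Φ₁.obj (op (PreFrobenioid.baseObj F₁ A))) ≃
      Primes (Φ₂.obj (op (PreFrobenioid.baseObj F₂ (Ψ.functor.obj A)))))
    {A A' : C₁} (γ : A ⟶ A') : Prop :=
  ∀ (𝔭 : Primes (Φ₁.obj (op (PreFrobenioid.baseObj F₁ A))))
    (𝔭' : Primes (Φ₁.obj (op (PreFrobenioid.baseObj F₁ A')))),
    (∃ p' ∈ 𝔭'.carrier, pull Φ₁ (PreFrobenioid.Base F₁ γ) p' ∈ 𝔭.carrier) →
      ∃ q' ∈ (e A' 𝔭').carrier, pull Φ₂ (PreFrobenioid.Base F₂ (Ψ.functor.map γ)) q' ∈ (e A 𝔭).carrier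

/-- **T42-L09** `PsiPrimeFunctorialFrobeniusType` (p. 80 ll. 34–43): "`Ψ^Prime(−)` is compatible (with the
evident functoriality of `Prime(Φ₁(−))`, `Prime(Φ₂(−))`) with respect to morphisms of Frobenius type
… [cf. Theorem 3.4, (iii)] … by considering commutative diagrams [with primary-step rows and Frobenius-type
columns, Proposition 1.10, (i)]" — for every family `e` with the clauses of row L08.
[cite: MochizukiFrdI2008, Thm. 4.2 (ii) p.80] -/
def PsiPrimeFunctorialFrobeniusType : Prop :=
  ∀ {D₁ : Type u} [Category.{v} D₁] {Φ₁ : D₁ᵒᵖ ⥤ CommMonCat.{w}} {C₁ : Type u'} [Category.{v'} C₁]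
    {D₂ : Type u} [Category.{v} D₂] {Φ₂ : D₂ᵒᵖ ⥤ CommMonCat.{w}} {C₂ : Type u'} [Category.{v'} C₂]
    (F₁ : C₁ ⥤ ElemFrobenioid Φ₁) (F₂ : C₂ ⥤ ElemFrobenioid Φ₂) (Ψ : C₁ ≌ C₂), Setting F₁ F₂ Ψ →
    (∀ ⦃X Y : C₁⦄ (φ : X ⟶ Y), PreFrobenioid.IsPrimaryPreStep F₁ φ →
        PreFrobenioid.IsPrimaryPreStep F₂ (Ψ.functor.map φ)) →
    ∀ (e : ∀ A : C₁, Primes (Φ₁.obj (op (PreFrobenioid.baseObj F₁ A))) ≃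
        Primes (Φ₂.obj (op (PreFrobenioid.baseObj F₂ (Ψ.functor.obj A))))),
      (∀ (A : C₁) ⦃E : C₁⦄ (ε : E ⟶ A) (hε : PreFrobenioid.IsPrimaryPreStep F₁ ε)
          (𝔭 : Primes (Φ₁.obj (op (PreFrobenioid.baseObj F₁ A)))),
          PreFrobenioid.invDiv F₁ ε hε.1.2 ∈ 𝔭.carrier →
            ∀ h₂ : PreFrobenioid.IsBaseIso F₂ (Ψ.functor.map ε),
              PreFrobenioid.invDiv F₂ (Ψ.functor.map ε) h₂ ∈ (e A 𝔭).carrier) →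
      ∀ {A A' : C₁} (γ : A ⟶ A'), PreFrobenioid.IsFrobeniusType F₁ γ → PrimesCompatibleAlong F₁ F₂ Ψ e γ

/-- **T42-L10** `PsiPrimeFunctorialPreStep` (p. 80 l. 44 – p. 81 l. 4): the same compatibility "with respect
to pre-steps … by considering commutative diagrams [3 × 2, pre-steps] … either the vertical morphisms of the
lower square are isomorphisms, or the lower square is a cartesian diagram as in Proposition 4.1, (iii)";
with Prop. 1.7 (ii) (base-isomorphisms = pre-step ∘ Frobenius type) and row L09 this is the functoriality of
`Ψ^Prime(−)` on `C^bs-iso`. [cite: MochizukiFrdI2008, Thm. 4.2 (ii) p.81] -/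
def PsiPrimeFunctorialPreStep : Prop :=
  ∀ {D₁ : Type u} [Category.{v} D₁] {Φ₁ : D₁ᵒᵖ ⥤ CommMonCat.{w}} {C₁ : Type u'} [Category.{v'} C₁]
    {D₂ : Type u} [Category.{v} D₂] {Φ₂ : D₂ᵒᵖ ⥤ CommMonCat.{w}} {C₂ : Type u'} [Category.{v'} C₂]
    (F₁ : C₁ ⥤ ElemFrobenioid Φ₁) (F₂ : C₂ ⥤ ElemFrobenioid Φ₂) (Ψ : C₁ ≌ C₂), Setting F₁ F₂ Ψ →
    (∀ ⦃X Y : C₁⦄ (φ : X ⟶ Y), PreFrobenioid.IsPrimaryPreStep F₁ φ →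
        PreFrobenioid.IsPrimaryPreStep F₂ (Ψ.functor.map φ)) →
    ∀ (e : ∀ A : C₁, Primes (Φ₁.obj (op (PreFrobenioid.baseObj F₁ A))) ≃
        Primes (Φ₂.obj (op (PreFrobenioid.baseObj F₂ (Ψ.functor.obj A))))),
      (∀ (A : C₁) ⦃E : C₁⦄ (ε : E ⟶ A) (hε : PreFrobenioid.IsPrimaryPreStep F₁ ε)
          (𝔭 : Primes (Φ₁.obj (op (PreFrobenioid.baseObj F₁ A)))),
          PreFrobenioid.invDiv F₁ ε hε.1.2 ∈ 𝔭.carrier →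
            ∀ h₂ : PreFrobenioid.IsBaseIso F₂ (Ψ.functor.map ε),
              PreFrobenioid.invDiv F₂ (Ψ.functor.map ε) h₂ ∈ (e A 𝔭).carrier) →
      ∀ {A A' : C₁} (γ : A ⟶ A'), PreFrobenioid.IsPreStep F₁ γ → PrimesCompatibleAlong F₁ F₂ Ψ e γ

/-! ## T42-L11 — Div-identity endomorphisms (p. 81 ll. 5–31) -/

/-- **T42-L11** `DivIdentityEndoCharacterisation` (p. 81 ll. 5–31): "since the `Φ_i` are non-dilating, …
`α ∈ End(A)` is a Div-identity endomorphism if and only if `α` admits a factorization `α = β ∘ γ`, where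
`β : B → A` is a pull-back morphism, and `γ : A → B` is a base-isomorphism, such that for every primary step
`A′ → A`, there exists a commutative diagram [`A′ → A` / `γ′`, `γ` / `B′ → B` / `β′`, `β` / `A″ → A`] in which
the horizontal morphisms are primary steps …; the equivalence classes of the primary steps `A′ → A`,
`B′ → B` correspond via `Prime(Φ_i(γ))` …; `β′` is a pull-back morphism [cf. Proposition 1.11, (v)]; the
primary steps `A′ → A`, `A″ → A` determine the same element of `Prime(Φ_i(A))`." — in a Frobenioid of perfect
and isotropic type with `Φ` perf-factorial and non-dilating. [cite: MochizukiFrdI2008, Thm. 4.2 (i) p.81] -/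
def DivIdentityEndoCharacterisation : Prop :=
  ∀ {D : Type u} [Category.{v} D] {Φ : Dᵒᵖ ⥤ CommMonCat.{w}} {C : Type u'} [Category.{v'} C]
    (F : C ⥤ ElemFrobenioid Φ), PreFrobenioid.IsFrobenioid F → PreFrobenioid.IsOfPerfectType F →
    PreFrobenioid.IsOfIsotropicType F → Objectwise (fun M _ => IsPerfFactorial M) Φ → IsNonDilatingOn Φ →
    ∀ {A : C}, ¬ PreFrobenioid.IsGroupLikeObj F A → ∀ (α : A ⟶ A),
      PreFrobenioid.IsDivIdentity F α ↔
        ∃ (B : C) (γ : A ⟶ B) (β : B ⟶ A), γ ≫ β = α ∧ PreFrobenioid.IsBaseIso F γ ∧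
          PreFrobenioid.IsPullbackMorphism F β ∧
          ∀ ⦃A' : C⦄ (ε : A' ⟶ A), PreFrobenioid.IsStep F ε → PreFrobenioid.IsPrimaryPreStep F ε →
            ∃ (B' A'' : C) (γ' : A' ⟶ B') (η : B' ⟶ B) (β' : B' ⟶ A'') (ε'' : A'' ⟶ A),
              ε ≫ γ = γ' ≫ η ∧ η ≫ β = β' ≫ ε'' ∧
              PreFrobenioid.IsStep F η ∧ PreFrobenioid.IsPrimaryPreStep F η ∧
              PreFrobenioid.IsStep F ε'' ∧ PreFrobenioid.IsPrimaryPreStep F ε'' ∧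
              PreFrobenioid.IsPullbackMorphism F β' ∧
              -- `A′ → A`, `B′ → B` correspond via `Prime(Φ(γ))`: `Base(γ)^*` carries `x_η` into the prime of `x_ε`
              (∀ (hε : PreFrobenioid.IsBaseIso F ε) (hη : PreFrobenioid.IsBaseIso F η),
                ∃ 𝔭 : Primes (Φ.obj (op (PreFrobenioid.baseObj F A))),
                  PreFrobenioid.invDiv F ε hε ∈ 𝔭.carrier ∧
                    pull Φ (PreFrobenioid.Base F γ) (PreFrobenioid.invDiv F η hη) ∈ 𝔭.carrier) ∧
              -- `A′ → A`, `A″ → A` determine the same prime of `Φ(A)`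
              ∀ (hε : PreFrobenioid.IsBaseIso F ε) (hε'' : PreFrobenioid.IsBaseIso F ε''),
                ∃ 𝔭 : Primes (Φ.obj (op (PreFrobenioid.baseObj F A))),
                  PreFrobenioid.invDiv F ε hε ∈ 𝔭.carrier ∧ PreFrobenioid.invDiv F ε'' hε'' ∈ 𝔭.carrier

/-- **T42-L11, conclusion** `PreservesDivIdentity` (p. 81 l. 5: "`Ψ` preserves Div-identity endomorphisms"),
in the perfect-type setting with `Φ_i` non-dilating, given rows L07 (primary steps) and L09/L10
(functoriality of `Ψ^Prime`). [cite: MochizukiFrdI2008, Thm. 4.2 (i) p.81] -/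
def PreservesDivIdentity : Prop :=
  ∀ {D₁ : Type u} [Category.{v} D₁] {Φ₁ : D₁ᵒᵖ ⥤ CommMonCat.{w}} {C₁ : Type u'} [Category.{v'} C₁]
    {D₂ : Type u} [Category.{v} D₂] {Φ₂ : D₂ᵒᵖ ⥤ CommMonCat.{w}} {C₂ : Type u'} [Category.{v'} C₂]
    (F₁ : C₁ ⥤ ElemFrobenioid Φ₁) (F₂ : C₂ ⥤ ElemFrobenioid Φ₂) (Ψ : C₁ ≌ C₂), Setting F₁ F₂ Ψ →
    IsNonDilatingOn Φ₁ → IsNonDilatingOn Φ₂ →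
    (∀ ⦃X Y : C₁⦄ (φ : X ⟶ Y), PreFrobenioid.IsPrimaryPreStep F₁ φ →
        PreFrobenioid.IsPrimaryPreStep F₂ (Ψ.functor.map φ)) →
    (∀ ⦃X Y : C₂⦄ (φ : X ⟶ Y), PreFrobenioid.IsPrimaryPreStep F₂ φ →
        PreFrobenioid.IsPrimaryPreStep F₁ (Ψ.inverse.map φ)) →
    ∀ (A : C₁), ¬ PreFrobenioid.IsGroupLikeObj F₁ A → ∀ α : A ⟶ A,
      PreFrobenioid.IsDivIdentity F₁ α → PreFrobenioid.IsDivIdentity F₂ (Ψ.functor.map α)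


end FrdI.T42

end Literature.AlgebraicGeometry.Frobenioids
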